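import Mathlib
import Summits.Ventures.PercRepro2.Defs
import Summits.Ventures.PercRepro2.Harris
import Summits.Ventures.PercRepro2.CoinDefs
import Summits.Ventures.PercRepro2.CoinStarDefs
import Summits.Ventures.PercRepro2.CoinLsmCoreDefs
import Summits.Ventures.PercRepro2.CoinLsmCoreU
import Summits.Ventures.PercRepro2.CoinCoreGate
import Summits.Ventures.PercRepro2.CoinOrTailKDefs
import Summits.Ventures.PercRepro2.CoinOrTailKSums
import Summits.Ventures.PercRepro2.CoinOrTailKAlg
import Summits.Ventures.PercRepro2.CoinOrTailKCore
import Summits.Ventures.PercRepro2.CoinOrTailLsmCore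
import Summits.Ventures.PercRepro2.CoinTreeCore
import Summits.Ventures.PercRepro2.CoinKSureGen
import Summits.Ventures.PercRepro2.CoinFourAtomPush

/-!
# The chained OR-vertex with COVERING MARKERS — row 2′DARC beyond log-supermodular cores
(blind cell PercRepro2, night-2 g17; proofs/NIGHT2-DARC.md §57)

The chain `a' → a` of §56: a second OR-vertex `a'` entered from `ent' ⊆ U` (ANY coins), the
free-arc vertex `a` entered from `ent ⊆ insert a' U` (ANY coins — the chain arc `a' → a` among
them).  For `|ent'| ≥ 2` the core `U ∪ {a'}` is NOT log-supermodular (the AND-switch, §56.1) and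
none of the OR-tail theorems applies.  But after the two level reductions (`sum_R_eq`/`sum_G_eq`
over `a`, `sum_gen` over `a'`) the `R`-law and the gate on the core `U` are NESTED OR-TAIL VALUES
`ν · rValK (rValK A …) …` / `ν · rValK (gValK A …) …` — log-supermodular by `rValK_mul_le_all`
applied twice (the inner value is nonnegative, decreasing and log-supermodular) — and when the
markers COVER the entries (`ent ∪ ent' ⊆ {a', m₁, m₂}`) the gate equals the `R`-law on every level
missing both markers.  The four-atom sandwich on the core (`fourAtom_functional_nonneg`) closes:
**`darc_of_chainCover`** — the first kernel theorem of the row for a chained OR-vertex with two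
`a'`-entries over an arbitrary log-supermodular core; `darc_of_chainTreeCover` the out-tree
corollary.  The argument never sees a clean-state decomposition: it is the covering-marker
(block) theorem of §39 re-proved by the pushforward, valid for EVERY pair of log-supermodular laws.
-/

namespace Summit.Ventures.PercRepro2.Coin

open Classical

section ValKMono

variable {V : Type*} {E : Type*} [DecidableEq V] {R : Type*} [Field R] [LinearOrder R]
  [IsStrictOrderedRing R]

/-- The tail weight is decreasing in the cluster. -/
lemma tailWtK_antitone {pr : E → R} (hp0 : ∀ e, 0 ≤ pr e) (hp1 : ∀ e, pr e ≤ 1)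
    (ent : Finset V) (c : V → E) {s t : Finset V} (hst : s ⊆ t) :
    tailWtK pr ent c t ≤ tailWtK pr ent c s := by
  unfold tailWtK
  refine Finset.prod_le_prod (fun r _ => ?_) (fun r _ => ?_)
  · have := hp1 (c r); split_ifs <;> linarith
  · have := hp0 (c r)
    by_cases hs : r ∈ s
    · rw [if_pos hs, if_pos (hst hs)]
    · rw [if_neg hs]; split_ifs <;> linarith

/-- `rValK` of a decreasing head is decreasing. -/
lemma rValK_antitone {A : Finset V → R} {pr : E → R} (hp0 : ∀ e, 0 ≤ pr e) (hp1 : ∀ e, pr e ≤ 1)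
    (hmono : ∀ s t : Finset V, s ⊆ t → A t ≤ A s) (ent : Finset V) (c : V → E) (a : V)
    {s t : Finset V} (hst : s ⊆ t) : rValK A pr ent c a t ≤ rValK A pr ent c a s := by
  unfold rValK
  have h0 := tailWtK_nonneg hp1 ent c t
  have h1 := tailWtK_le_one hp0 hp1 ent c s
  have hw := tailWtK_antitone hp0 hp1 ent c hst
  have e1 := hmono _ _ hst
  have e2 := hmono _ _ (Finset.union_subset_union_left hst : s ∪ {a} ⊆ t ∪ {a})
  have e3 := hmono _ _ (Finset.subset_union_left : s ⊆ s ∪ {a})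
  nlinarith

/-- `gValK` of a decreasing head is decreasing. -/
lemma gValK_antitone {A : Finset V → R} {pr : E → R} (hp0 : ∀ e, 0 ≤ pr e) (hp1 : ∀ e, pr e ≤ 1)
    (hmono : ∀ s t : Finset V, s ⊆ t → A t ≤ A s) (ent : Finset V) (c : V → E) (a w : V)
    {s t : Finset V} (hst : s ⊆ t) : gValK A pr ent c a w t ≤ gValK A pr ent c a w s := by
  unfold gValK
  have h0 := tailWtK_nonneg hp1 ent c t
  have h1 := tailWtK_le_one hp0 hp1 ent c s
  have hw := tailWtK_antitone hp0 hp1 ent c hst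
  have e1 := hmono _ _ hst
  have e2 := hmono _ _ (Finset.union_subset_union_left hst : s ∪ {a, w} ⊆ t ∪ {a, w})
  have e3 := hmono _ _ (Finset.subset_union_left : s ⊆ s ∪ {a, w})
  nlinarith

/-- `rValK` is monotone in the head. -/
lemma rValK_head_le {F F' : Finset V → R} {pr : E → R} (hp0 : ∀ e, 0 ≤ pr e)
    (hp1 : ∀ e, pr e ≤ 1) (hle : ∀ W, F W ≤ F' W) (ent : Finset V) (c : V → E) (a : V)
    (W : Finset V) : rValK F pr ent c a W ≤ rValK F' pr ent c a W := by
  unfold rValK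
  have h0 := tailWtK_nonneg hp1 ent c W
  have h1 := tailWtK_le_one hp0 hp1 ent c W
  have := hle W
  have := hle (W ∪ {a})
  nlinarith

omit [LinearOrder R] [IsStrictOrderedRing R] in
/-- On a cluster without entries `rValK` is the head value. -/
lemma rValK_eq_of_no_entry (F : Finset V → R) (pr : E → R) {ent : Finset V} (c : V → E) (a : V)
    {W : Finset V} (hW : ∀ r ∈ ent, r ∉ W) : rValK F pr ent c a W = F W := by
  unfold rValK
  rw [tailWtK_eq_one_of_no_entry pr c hW]
  ring

end ValKMono

section ChainCover

variable {V : Type*} {E : Type*} [Fintype V] [DecidableEq V] [Fintype E] [DecidableEq E]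
  {R : Type*} [Field R] [LinearOrder R] [IsStrictOrderedRing R]
  {arcs : E → Finset (V × V)} {s : V} {U : Finset V} {ent ent' : Finset V} {c c' : V → E}
  {a a' w : V}

/-- **THEOREM (row 2′DARC at a CHAINED OR-VERTEX with COVERING MARKERS).** `a'` an OR-vertex of
the core `U` entered from `ent' ⊆ U` by ANY coins, `a` an OR-vertex of `insert a' U` entered from
`ent ⊆ insert a' U` by ANY coins (the chain arc `a' → a` among them), `SameEnds`, the cluster law
of `U` log-supermodular, the two markers `m₁, m₂ ∈ U` COVERING the entries
(`ent' ⊆ {m₁, m₂}`, `ent ⊆ {a', m₁, m₂}`), `t, w ∉ U ∪ {a, a', s}` ⟹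
`Φ_D({s ↛ t in D + (a → w)}) ≥ 0` for the markers `m₁, m₂`, every head, every probability
vector.  In particular `ent' = {m₁, m₂}` with `a` entered only from `a'`: the two-entry chain of
§56 over EVERY log-supermodular core, for which no clean-state decomposition closes. -/
theorem darc_of_chainCover (pr : E → R) (hp : IsProbVec pr) (hS : SameEnds arcs)
    (h' : OrTailK arcs s U ent' c' a') (h : OrTailK arcs s (insert a' U) ent c a)
    {m₁ m₂ : V} (hm₁ : m₁ ∈ U) (hm₂ : m₂ ∈ U)
    (hcov' : ∀ r ∈ ent', r = m₁ ∨ r = m₂) (hcov : ∀ r ∈ ent, r = a' ∨ r = m₁ ∨ r = m₂)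
    (hν : ∀ W W', W ⊆ U → W' ⊆ U →
      prob pr (coreLevel arcs s U W) * prob pr (coreLevel arcs s U W') ≤
        prob pr (coreLevel arcs s U (W ∩ W')) * prob pr (coreLevel arcs s U (W ∪ W')))
    {t : V} (htC : t ∉ insert a (insert a' U)) (hts : t ≠ s) (hws : w ≠ s)
    (hwC : w ∉ insert a (insert a' U)) :
    DARC pr arcs s {t} m₁ m₂ a w := by
  have hC := h.closedInCoreU
  have ha'U : a' ∉ U := h'.a_notin
  have haU' : a ∉ insert a' U := h.a_notin
  have hm₁a : m₁ ≠ a := fun e => haU' (e ▸ Finset.mem_insert_of_mem hm₁)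
  have hm₂a : m₂ ≠ a := fun e => haU' (e ▸ Finset.mem_insert_of_mem hm₂)
  have hm₁a' : m₁ ≠ a' := fun e => ha'U (e ▸ hm₁)
  have hm₂a' : m₂ ≠ a' := fun e => ha'U (e ▸ hm₂)
  have hm₁C : m₁ ∈ insert a (insert a' U) :=
    Finset.mem_insert_of_mem (Finset.mem_insert_of_mem hm₁)
  have hm₂C : m₂ ∈ insert a (insert a' U) :=
    Finset.mem_insert_of_mem (Finset.mem_insert_of_mem hm₂)
  have haC : a ∈ insert a (insert a' U) := Finset.mem_insert_self _ _
  unfold DARC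
  rw [hC.phiC_gate_eq pr hS htC hts hm₁C hm₂C haC hws hwC]
  -- the marker functions and their invariances
  have hm1 : ∀ W : Finset V, (fun _ : Finset V => (1 : R)) (insert a W) = (fun _ => (1 : R)) W :=
    fun _ => rfl
  have hm1' : ∀ W : Finset V, (fun _ : Finset V => (1 : R)) (insert a' W) = (fun _ => (1 : R)) W :=
    fun _ => rfl
  have hmp : ∀ W : Finset V, (fun W : Finset V => if m₁ ∈ W then (1 : R) else 0) (insert a W) =
      (fun W : Finset V => if m₁ ∈ W then (1 : R) else 0) W := by
    intro W; simp only [Finset.mem_insert, hm₁a, false_or]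
  have hmp' : ∀ W : Finset V, (fun W : Finset V => if m₁ ∈ W then (1 : R) else 0) (insert a' W) =
      (fun W : Finset V => if m₁ ∈ W then (1 : R) else 0) W := by
    intro W; simp only [Finset.mem_insert, hm₁a', false_or]
  have hmq : ∀ W : Finset V, (fun W : Finset V => if m₂ ∈ W then (1 : R) else 0) (insert a W) =
      (fun W : Finset V => if m₂ ∈ W then (1 : R) else 0) W := by
    intro W; simp only [Finset.mem_insert, hm₂a, false_or]
  have hmq' : ∀ W : Finset V, (fun W : Finset V => if m₂ ∈ W then (1 : R) else 0) (insert a' W) =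
      (fun W : Finset V => if m₂ ∈ W then (1 : R) else 0) W := by
    intro W; simp only [Finset.mem_insert, hm₂a', false_or]
  have hmpq : ∀ W : Finset V,
      (fun W : Finset V => (if m₁ ∈ W then (1 : R) else 0) * (if m₂ ∈ W then (1 : R) else 0))
        (insert a W) =
      (fun W : Finset V => (if m₁ ∈ W then (1 : R) else 0) * (if m₂ ∈ W then (1 : R) else 0)) W := by
    intro W; simp only [Finset.mem_insert, hm₁a, hm₂a, false_or]
  have hmpq' : ∀ W : Finset V,
      (fun W : Finset V => (if m₁ ∈ W then (1 : R) else 0) * (if m₂ ∈ W then (1 : R) else 0))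
        (insert a' W) =
      (fun W : Finset V => (if m₁ ∈ W then (1 : R) else 0) * (if m₂ ∈ W then (1 : R) else 0)) W := by
    intro W; simp only [Finset.mem_insert, hm₁a', hm₂a', false_or]
  -- the level reduction over `a` (core `insert a' U`)
  have eΛ := h.sum_R_eq pr t (fun _ => (1 : R)) hm1
  have eFa := h.sum_R_eq pr t (fun W => if m₁ ∈ W then (1 : R) else 0) hmp
  have eFb := h.sum_R_eq pr t (fun W => if m₂ ∈ W then (1 : R) else 0) hmq
  have eM := h.sum_G_eq (w := w) pr t (fun _ => (1 : R)) hm1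
  have eX := h.sum_G_eq (w := w) pr t (fun W => if m₁ ∈ W then (1 : R) else 0) hmp
  have eY := h.sum_G_eq (w := w) pr t (fun W => if m₂ ∈ W then (1 : R) else 0) hmq
  have eXY := h.sum_G_eq (w := w) pr t
    (fun W => (if m₁ ∈ W then (1 : R) else 0) * (if m₂ ∈ W then (1 : R) else 0)) hmpq
  simp only [mul_one] at eΛ eM
  rw [eΛ, eFa, eFb, eM, eX, eY, eXY]
  set A : Finset V → R := fun X => prob pr (coreAvoidEvent arcs s t (insert a (insert a' U)) X)
    with hAdef
  -- the level reduction over `a'` (core `U`)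
  have fΛ := h'.sum_gen pr (rValK A pr ent c a) (fun _ => (1 : R)) hm1'
  have fFa := h'.sum_gen pr (rValK A pr ent c a) (fun W => if m₁ ∈ W then (1 : R) else 0) hmp'
  have fFb := h'.sum_gen pr (rValK A pr ent c a) (fun W => if m₂ ∈ W then (1 : R) else 0) hmq'
  have fM := h'.sum_gen pr (gValK A pr ent c a w) (fun _ => (1 : R)) hm1'
  have fX := h'.sum_gen pr (gValK A pr ent c a w) (fun W => if m₁ ∈ W then (1 : R) else 0) hmp'
  have fY := h'.sum_gen pr (gValK A pr ent c a w) (fun W => if m₂ ∈ W then (1 : R) else 0) hmq'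
  have fXY := h'.sum_gen pr (gValK A pr ent c a w)
    (fun W => (if m₁ ∈ W then (1 : R) else 0) * (if m₂ ∈ W then (1 : R) else 0)) hmpq'
  simp only [mul_one] at fΛ fM
  rw [fΛ, fFa, fFb, fM, fX, fY, fXY]
  -- the head and the inner OR-tail values
  obtain ⟨hA0, hAmono, hAlsm⟩ := OrTailU.head_props (U := insert a' U) (a := a) pr hp hS t
  have hp0 := hp.nonneg
  have hp1 := hp.le_one
  set FR : Finset V → R := rValK A pr ent c a with hFR
  set FG : Finset V → R := gValK A pr ent c a w with hFG
  have hFR0 : ∀ W, 0 ≤ FR W := fun W => rValK_nonneg hp0 hp1 hA0 ent c a W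
  have hFG0 : ∀ W, 0 ≤ FG W := fun W => gValK_nonneg hp0 hp1 hA0 ent c a w W
  have hFRlsm : ∀ s t : Finset V, FR s * FR t ≤ FR (s ∩ t) * FR (s ∪ t) :=
    fun s t => rValK_mul_le_all A pr ent c a hp0 hp1 hA0 hAlsm hAmono s t
  have hFGlsm : ∀ s t : Finset V, FG s * FG t ≤ FG (s ∩ t) * FG (s ∪ t) :=
    fun s t => gValK_mul_le_all A pr ent c a w hp0 hp1 hA0 hAlsm hAmono s t
  have hFRmono : ∀ s t : Finset V, s ⊆ t → FR t ≤ FR s :=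
    fun s t hst => rValK_antitone hp0 hp1 hAmono ent c a hst
  have hFGmono : ∀ s t : Finset V, s ⊆ t → FG t ≤ FG s :=
    fun s t hst => gValK_antitone hp0 hp1 hAmono ent c a w hst
  have hFGle : ∀ W, FG W ≤ FR W := fun W => gValK_le_rValK hp0 hp1 hAmono ent c a w W
  -- the outer (chain) values and the two laws on the core
  set ν : Finset V → R := fun W => prob pr (coreLevel arcs s U W) with hνdef
  have hν0 : ∀ W, 0 ≤ ν W := fun W => prob_nonneg hp _
  set G : Finset V → R := fun W => ν W * rValK FR pr ent' c' a' W with hGdef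
  set G' : Finset V → R := fun W => ν W * rValK FG pr ent' c' a' W with hG'def
  have hG0 : ∀ W, 0 ≤ G W := fun W => mul_nonneg (hν0 W) (rValK_nonneg hp0 hp1 hFR0 ent' c' a' W)
  have hG'0 : ∀ W, 0 ≤ G' W := fun W => mul_nonneg (hν0 W) (rValK_nonneg hp0 hp1 hFG0 ent' c' a' W)
  have wLL : ∀ s ⊆ U, ∀ t ⊆ U, G s * G t ≤ G (s ∩ t) * G (s ∪ t) := by
    intro s hs t ht
    simp only [hGdef]
    calc ν s * rValK FR pr ent' c' a' s * (ν t * rValK FR pr ent' c' a' t)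
        = (ν s * ν t) * (rValK FR pr ent' c' a' s * rValK FR pr ent' c' a' t) := by ring
      _ ≤ (ν (s ∩ t) * ν (s ∪ t)) *
            (rValK FR pr ent' c' a' (s ∩ t) * rValK FR pr ent' c' a' (s ∪ t)) :=
          mul_le_mul (hν s t hs ht)
            (rValK_mul_le_all FR pr ent' c' a' hp0 hp1 hFR0 hFRlsm hFRmono s t)
            (mul_nonneg (rValK_nonneg hp0 hp1 hFR0 ent' c' a' _)
              (rValK_nonneg hp0 hp1 hFR0 ent' c' a' _))
            (mul_nonneg (hν0 _) (hν0 _))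
      _ = _ := by ring
  have wMM : ∀ s ⊆ U, ∀ t ⊆ U, G' s * G' t ≤ G' (s ∩ t) * G' (s ∪ t) := by
    intro s hs t ht
    simp only [hG'def]
    calc ν s * rValK FG pr ent' c' a' s * (ν t * rValK FG pr ent' c' a' t)
        = (ν s * ν t) * (rValK FG pr ent' c' a' s * rValK FG pr ent' c' a' t) := by ring
      _ ≤ (ν (s ∩ t) * ν (s ∪ t)) *
            (rValK FG pr ent' c' a' (s ∩ t) * rValK FG pr ent' c' a' (s ∪ t)) :=
          mul_le_mul (hν s t hs ht)
            (rValK_mul_le_all FG pr ent' c' a' hp0 hp1 hFG0 hFGlsm hFGmono s t)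
            (mul_nonneg (rValK_nonneg hp0 hp1 hFG0 ent' c' a' _)
              (rValK_nonneg hp0 hp1 hFG0 ent' c' a' _))
            (mul_nonneg (hν0 _) (hν0 _))
      _ = _ := by ring
  have hle : ∀ W ∈ U.powerset, G' W ≤ G W := fun W _ =>
    mul_le_mul_of_nonneg_left (rValK_head_le hp0 hp1 hFGle ent' c' a' W) (hν0 W)
  have h00 : ∀ W ∈ U.powerset, m₁ ∉ W → m₂ ∉ W → G' W = G W := by
    intro W hW h1 h2
    have hWU : W ⊆ U := Finset.mem_powerset.1 hW
    have ha'W : a' ∉ W := fun hx => ha'U (hWU hx)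
    have hno' : ∀ r ∈ ent', r ∉ W := by
      intro r hr hrW
      rcases hcov' r hr with rfl | rfl
      · exact h1 hrW
      · exact h2 hrW
    have hno : ∀ r ∈ ent, r ∉ W := by
      intro r hr hrW
      rcases hcov r hr with rfl | rfl | rfl
      · exact ha'W hrW
      · exact h1 hrW
      · exact h2 hrW
    simp only [hGdef, hG'def]
    rw [rValK_eq_of_no_entry FR pr c' a' hno', rValK_eq_of_no_entry FG pr c' a' hno']
    simp only [hFR, hFG]
    rw [gValK_eq_rValK_of_no_entry A pr c a w hno]
  exact fourAtom_functional_nonneg' U G G' m₁ m₂ hG0 hG'0 wLL wMM hle h00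

/-- **COROLLARY (out-tree core).** `U` an out-tree core, the chain `a' → a` with ANY coins, the
markers covering the entries ⟹ row 2′DARC at `a → w` for every head and every probability
vector. -/
theorem darc_of_chainTreeCover (pr : E → R) (hp : IsProbVec pr) (hS : SameEnds arcs)
    (h' : OrTailK arcs s U ent' c' a') (h : OrTailK arcs s (insert a' U) ent c a)
    {cT : V → E} {par : V → V} {rk : V → ℕ} (hT : TreeCore arcs s U cT par rk)
    {m₁ m₂ : V} (hm₁ : m₁ ∈ U) (hm₂ : m₂ ∈ U)
    (hcov' : ∀ r ∈ ent', r = m₁ ∨ r = m₂) (hcov : ∀ r ∈ ent, r = a' ∨ r = m₁ ∨ r = m₂)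
    {t : V} (htC : t ∉ insert a (insert a' U)) (hts : t ≠ s) (hws : w ≠ s)
    (hwC : w ∉ insert a (insert a' U)) :
    DARC pr arcs s {t} m₁ m₂ a w :=
  darc_of_chainCover pr hp hS h' h hm₁ hm₂ hcov' hcov (hT.coreLevel_lsm pr hp) htC hts hws hwC

end ChainCover

end Summit.Ventures.PercRepro2.Coin
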